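import Summits.QuantumFields.BalabanUV.Beta.GAN24.BornLambdaDriftSup
import Summits.QuantumFields.BalabanUV.Beta.GAN24.BornLambdaUndressedDrift

/-!
# `BalabanUV.Beta.GAN24.BornLambdaDriftAssembly` — binder row G-an2-4 ∕ (CONV-C), CT-ROUTE (R8°), THE RATE HALF OF THE Λ-BORN ROW, ASSEMBLY:
# **`hBdev(0,cΛ)` OF THE `d = 3` COMB FAMILY ⟸ THE CONTACT PAIR LETTERS (births `≥ 1`) ALONE** — the dressed top-aligned pair splits pointwise as
# UNDRESSED pair + CONTACT pair; the undressed pairs are `BornLambdaUndressedDrift.exists_pairU_sup_three` («ROOTED-S3-Λ-DIFF»), the pair `i = 0` is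
# `BornLambdaDriftSup.exists_pairZero_lam_three`, and the socket is `BornLambdaDriftSup.exists_hBdevLam_three_of_supPairs`

NOT IN PRINT; OUR BOOKKEEPING (G-an2-4 formalisation swarm → CRUX TEAM (2), leaf prover `b2b-balaban-gan24-formalise-leaf-06`, gen 41).  HONEST FRAMING (cell
contract, verbatim): «discharging `BetaPertH` makes Bałaban's UV stability UNCONDITIONAL — a real constructive-QFT result; it is NOT the continuum limit and NOT
the Clay problem.»  HONEST DEPENDENCY (verbatim): «continuum YM on T⁴ ⇐ BetaPertH ∧ nine spine estimates (0/9 proved); BetaPertH ⇐ (D1) ∧ (D4) ∧ CAP+tail;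
G-an2-4 gates asym, D1 and NE2/3/4.»  [folklore] reindexing `(j, n) ↔ (k, i) = (j+n+2, j+1)` and the triangle inequality BY NAME; 0 `def`, 0 cited facts,
0 `def … : Prop`, 0 sorry; NO estimate of Bałaban's.  The END is a SOCKET: its ONE hypothesis — the CONTACT pair letter, i.e. leaf-02's (C4) cells with one
slot differenced — is OPEN; discharges NOTHING of (hS, hSall) on (E); NEVER «G-an2-4 closed» as (CONV-C); NOT D1, NOT `BetaPertH`, NOT continuum, NOT Clay.
Unit `b2b-balaban-gan24-formalise-leaf-06` (gen 41), 2026-08-21.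
-/

noncomputable section

open Finset
open scoped BigOperators
open Literature.MathematicalPhysics.QuantumFieldTheory
open Literature.MathematicalPhysics.QuantumFieldTheory.Balaban1983to89
open Literature.MathematicalPhysics.QuantumFieldTheory.Balaban1983to89.Beta
open ExpKernelCalculus (MKer)
open OneStepResolventKernel (Fib LocStencil)
open AffineAveraging (box toSite)
open BalabanCompositeJets (respStep)
open Summit.QuantumFields.BalabanUV.Beta.HessKerDressedUnits (unitS)
open Summit.QuantumFields.BalabanUV.Beta.GAN24.CombesThomas (sfStep smStep SupBound)
open Summit.QuantumFields.BalabanUV.Beta.GAN24.Push3 (push₃)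
open Summit.QuantumFields.BalabanUV.Beta.GAN24.Push4Iter (legChain)
open Summit.QuantumFields.BalabanUV.Beta.GAN24.RespStepBmDecompExact (respStepBmSeq)
open Summit.QuantumFields.BalabanUV.Beta.GAN24.SrecWilsonSector (bornSecAt)
open Summit.QuantumFields.BalabanUV.Beta.GAN24.SrecBornSector (freshAt)
open Summit.QuantumFields.BalabanUV.Beta.GAN24.BornLambdaDriftSup (exists_hBdevLam_three_of_supPairs exists_pairZero_lam_three
  locStencil_zero_iff_supBound locStencil_zero_of_locStencil)
open Summit.QuantumFields.BalabanUV.Beta.GAN24.BornLambdaUndressedDrift (exists_pairU_sup_three)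

namespace Summit.QuantumFields.BalabanUV.Beta.GAN24.BornLambdaDriftAssembly

variable {Lc : ℕ} [NeZero Lc]

/-- NOT IN PRINT; OUR PROOF ATTEMPT — A SOCKET (`d = 3`, `2 ≤ Lc`, pin `cE = Lc^4`; [folklore] assembly).  **THE RATE HALF `hBdev(0,cΛ)` OF THE Λ-BORN ROW FROM THE
CONTACT PAIR LETTERS ALONE**: if for every in-block root, every birth `i ≥ 1`, every `k > i` and every entry the CONTACT lineage of member `k+1` born at `i+1` minus
that of member `k` born at `i` — `(cE·Lc^8)^{k−i} • (push₃ T³ − push₃ B³)(unitS_· freshAt ·)` with the dressed chains `T = legChain (respStepBmSeq ρ Lc) · (k−1−i)` and the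
undressed `B = respStep (Lc^·) (Lc^·)` — is bounded by `CPc·(k−i)^q·Θc^k` (`Θc < 1`, NO decay asked), then the unit tables of `bornSecAt Lc ρ cE 0 cΛ` obey the
all-scales Cauchy letter `LocStencil (U_{k+j} − U_k) (cB·θB^k) δB` (ONE `cB`, `θB < 1`, `δB > 0`, all roots): the dressed pair = undressed pair
(`exists_pairU_sup_three`) + contact pair pointwise, the pair `i = 0` by `exists_pairZero_lam_three`, then `exists_hBdevLam_three_of_supPairs` with exponent `q+1`. -/
theorem exists_hBdevLam_three_of_contactPairs (hLc : 2 ≤ Lc) {cE : ℝ} (hcE : cE = (Lc : ℝ) ^ (3 + 1)) (cΛ : ℝ) (q : ℕ)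
    (hPc : ∃ CPc Θc : ℝ, 0 ≤ CPc ∧ 0 ≤ Θc ∧ Θc < 1 ∧ ∀ (rr : Fin (3 + 1) → ℕ), rr ∈ box (3 + 1) Lc → ∀ k i : ℕ, 1 ≤ i → i < k → ∀ κ u,
      SupBound
        (((fun κ' u' => (cE * (Lc : ℝ) ^ (2 * (3 + 1))) ^ (k - i) •
            (push₃ (legChain (respStepBmSeq (toSite rr) Lc) (i + 1) (k - 1 - i)) (legChain (respStepBmSeq (toSite rr) Lc) (i + 1) (k - 1 - i))
                (legChain (respStepBmSeq (toSite rr) Lc) (i + 1) (k - 1 - i))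
                (unitS (sfStep Lc (i + 1)) (smStep 3 Lc (i + 1)) (freshAt Lc (toSite rr) 0 cΛ (i + 1))) κ' u'
              - push₃ (respStep (d := 3) (Lc ^ (i + 1)) (Lc ^ (k + 1))) (respStep (d := 3) (Lc ^ (i + 1)) (Lc ^ (k + 1)))
                (respStep (d := 3) (Lc ^ (i + 1)) (Lc ^ (k + 1)))
                (unitS (sfStep Lc (i + 1)) (smStep 3 Lc (i + 1)) (freshAt Lc (toSite rr) 0 cΛ (i + 1))) κ' u'))
          - fun κ' u' => (cE * (Lc : ℝ) ^ (2 * (3 + 1))) ^ (k - i) •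
            (push₃ (legChain (respStepBmSeq (toSite rr) Lc) i (k - 1 - i)) (legChain (respStepBmSeq (toSite rr) Lc) i (k - 1 - i))
                (legChain (respStepBmSeq (toSite rr) Lc) i (k - 1 - i))
                (unitS (sfStep Lc i) (smStep 3 Lc i) (freshAt Lc (toSite rr) 0 cΛ i)) κ' u'
              - push₃ (respStep (d := 3) (Lc ^ i) (Lc ^ k)) (respStep (d := 3) (Lc ^ i) (Lc ^ k)) (respStep (d := 3) (Lc ^ i) (Lc ^ k))
                (unitS (sfStep Lc i) (smStep 3 Lc i) (freshAt Lc (toSite rr) 0 cΛ i)) κ' u')) κ u)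
        (CPc * ((((k - i : ℕ) : ℝ)) ^ q * Θc ^ k))) :
    ∃ cB θB δB : ℝ, 0 ≤ cB ∧ 0 ≤ θB ∧ θB < 1 ∧ 0 < δB ∧ ∀ (rr : Fin (3 + 1) → ℕ), rr ∈ box (3 + 1) Lc → ∀ k j : ℕ,
      LocStencil (unitS (sfStep Lc (k + j)) (smStep 3 Lc (k + j)) (bornSecAt Lc (toSite rr) cE 0 cΛ (k + j))
        - unitS (sfStep Lc k) (smStep 3 Lc k) (bornSecAt Lc (toSite rr) cE 0 cΛ k)) (cB * θB ^ k) δB := by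
  obtain ⟨CPc, Θc, hCPc, hΘc0, hΘc1, hPc⟩ := hPc
  obtain ⟨CU, ΘU, hCU, hΘU0, hΘU1, hU⟩ := exists_pairU_sup_three (Lc := Lc) hLc hcE cΛ
  obtain ⟨C₀, Θ₀, δ₀, hC₀, hΘ₀0, hΘ₀1, hδ₀, hZ⟩ := exists_pairZero_lam_three (Lc := Lc) hLc hcE cΛ
  -- one rate
  set Θ : ℝ := max (max ΘU Θc) Θ₀ with hΘ
  have hΘ0 : 0 ≤ Θ := hΘ₀0.trans (le_max_right _ _)
  have hΘ1 : Θ < 1 := max_lt (max_lt hΘU1 hΘc1) hΘ₀1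
  have hUΘ : ΘU ≤ Θ := (le_max_left _ _).trans (le_max_left _ _)
  have hcΘ : Θc ≤ Θ := (le_max_right _ _).trans (le_max_left _ _)
  have h0Θ : Θ₀ ≤ Θ := le_max_right _ _
  refine exists_hBdevLam_three_of_supPairs hLc hcE cΛ (q + 1)
    ⟨CU / ΘU + CPc + C₀, Θ, by positivity, hΘ0, hΘ1, fun rr hrr k i hik κ u x z a b => ?_⟩
  have hki : 1 ≤ ((k - i : ℕ) : ℝ) := by exact_mod_cast Nat.succ_le_of_lt (Nat.sub_pos_of_lt hik)
  have hkiq : ((k - i : ℕ) : ℝ) ^ q ≤ ((k - i : ℕ) : ℝ) ^ (q + 1) := by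
    rw [pow_succ]; exact le_mul_of_one_le_right (by positivity) hki
  have hkiq1 : 1 ≤ ((k - i : ℕ) : ℝ) ^ (q + 1) := one_le_pow₀ hki
  have hΘk : 0 ≤ Θ ^ k := pow_nonneg hΘ0 k
  rcases Nat.eq_zero_or_pos i with hi | hi
  · -- the pair `i = 0`: both members by the lineage letters (PART 2 §4), decay forgotten
    subst hi
    have h := (locStencil_zero_iff_supBound.1 (locStencil_zero_of_locStencil (hZ rr hrr k hik) hδ₀.le)) κ u x z a b
    refine h.trans ?_
    have hp : Θ₀ ^ k ≤ Θ ^ k := pow_le_pow_left₀ hΘ₀0 h0Θ k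
    have hk1 : ((k - 0 : ℕ) : ℝ) ^ 1 ≤ ((k - 0 : ℕ) : ℝ) ^ (q + 1) :=
      pow_le_pow_right₀ hki (by omega)
    calc C₀ * ((((k - 0 : ℕ) : ℝ)) ^ 1 * Θ₀ ^ k) ≤ C₀ * ((((k - 0 : ℕ) : ℝ)) ^ (q + 1) * Θ ^ k) := by gcongr
      _ ≤ (CU / ΘU + CPc + C₀) * ((((k - 0 : ℕ) : ℝ)) ^ (q + 1) * Θ ^ k) := by
          have : C₀ ≤ CU / ΘU + CPc + C₀ := by have := div_nonneg hCU hΘU0.le; linarith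
          exact mul_le_mul_of_nonneg_right this (by positivity)
  · -- births `i ≥ 1`: dressed pair = undressed pair + contact pair
    obtain ⟨j, rfl⟩ : ∃ j, i = j + 1 := ⟨i - 1, by omega⟩
    obtain ⟨n, rfl⟩ : ∃ n, k = j + n + 1 + 1 := ⟨k - j - 2, by omega⟩
    have hC := hPc rr hrr (j + n + 1 + 1) (j + 1) hi hik κ u x z a b
    have hUp := hU rr hrr j n κ u x z a b
    dsimp only at hC hUp ⊢
    have ek : j + n + 1 + 1 - (j + 1) = n + 1 := by omega
    have el : j + n + 1 + 1 - 1 - (j + 1) = n := by omega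
    have em : j + 1 + n + 1 + 1 = j + n + 1 + 1 + 1 := by omega
    rw [em] at hUp
    rw [ek] at hki hkiq hkiq1
    simp only [ek, el] at hC ⊢
    simp only [Pi.sub_apply, Pi.smul_apply, smul_eq_mul] at hC hUp ⊢
    rw [mul_sub, mul_sub] at hC
    -- `|a − c| ≤ |b − d| + |(a − b) − (c − d)|`
    have h4 : ∀ a' b' c' d' : ℝ, |a' - c'| ≤ |b' - d'| + |a' - b' - (c' - d')| := fun a' b' c' d' => by
      have e : a' - c' = (b' - d') + (a' - b' - (c' - d')) := by ring
      rw [e]; exact abs_add_le _ _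
    refine (h4 _ _ _ _).trans ((add_le_add hUp hC).trans ?_)
    -- the two letters against the common constant
    set X : ℝ := (((n + 1 : ℕ) : ℝ)) ^ (q + 1) * Θ ^ (j + n + 1 + 1) with hX
    have hX0 : 0 ≤ X := by positivity
    have hUb : CU * ΘU ^ (j + n + 1) ≤ CU / ΘU * X := by
      have e : CU * ΘU ^ (j + n + 1) = CU / ΘU * ΘU ^ (j + n + 1 + 1) := by
        rw [pow_succ]; field_simp; ring
      rw [e, hX]
      refine mul_le_mul_of_nonneg_left ?_ (div_nonneg hCU hΘU0.le)
      calc ΘU ^ (j + n + 1 + 1) ≤ Θ ^ (j + n + 1 + 1) := pow_le_pow_left₀ hΘU0.le hUΘ _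
        _ = 1 * Θ ^ (j + n + 1 + 1) := (one_mul _).symm
        _ ≤ (((n + 1 : ℕ) : ℝ)) ^ (q + 1) * Θ ^ (j + n + 1 + 1) := mul_le_mul_of_nonneg_right hkiq1 (pow_nonneg hΘ0 _)
    have hCb : CPc * ((((n + 1 : ℕ) : ℝ)) ^ q * Θc ^ (j + n + 1 + 1)) ≤ CPc * X := by
      rw [hX]
      refine mul_le_mul_of_nonneg_left ?_ hCPc
      have hp : Θc ^ (j + n + 1 + 1) ≤ Θ ^ (j + n + 1 + 1) := pow_le_pow_left₀ hΘc0 hcΘ _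
      exact mul_le_mul hkiq hp (pow_nonneg hΘc0 _) (by positivity)
    have hC0b : 0 ≤ C₀ * X := mul_nonneg hC₀ hX0
    have e : (CU / ΘU + CPc + C₀) * X = CU / ΘU * X + CPc * X + C₀ * X := by ring
    rw [e]
    linarith

end Summit.QuantumFields.BalabanUV.Beta.GAN24.BornLambdaDriftAssembly

end
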